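import Literature.Geometry.Kaehler.CechDeRhamTransgression
import Summits.HodgeConjecture.HodgeConjecture.Theorems.MilnorKExponentialSymbolLiftRCupStepForms
import HarnessLib

/-!
# Cup step for `SymbolLiftR` (route `MilnorKExponential`), III: refinement and products of transgressions

Helper file for the stub `stub_cupStep` (S3) of the line `lefschetz-fold` of the crux `SymbolLiftR`
(item stmt-HodgeConjecture-18702). Zig-zags (`Literature.Geometry.Kaehler.IsTransgression`, Bott–Tu
(1982), Prop. 8.8) restrict along a refinement of the cover (`isTransgression_comap`), their top may
be changed off the `U_J` (`isTransgression_congr_top`), and **they multiply** (`isTransgression_cup`):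
from a zig-zag of parameter `q` (top `w`, bottom `θ`) and a weight-one zig-zag (top `w'`, bottom `θ'`)
on the same cover, an explicit product zig-zag transgresses the cup product
`J ↦ w_{J₀…J_{q+1}} ∧ w'_{J_{q+1}J_{q+2}}` to `(-1)^{q+1} θ ∧ θ'` (Bott–Tu (1982), §8–§9 and Thm. 14.28:
the Čech–de Rham isomorphism is multiplicative). Everything is proved; no definitions.

## References

* R. Bott, L. W. Tu, *Differential Forms in Algebraic Topology* (1982), §8 Prop. 8.8, Thm. 14.28.
* F. W. Warner, *Foundations of Differentiable Manifolds and Lie Groups* (1983), Thm. 2.20.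
-/

noncomputable section

-- the mandated namespace `Summit.HodgeConjecture.HodgeConjecture.…` repeats a component
set_option linter.dupNamespace false

open scoped Manifold ContDiff

namespace Summit.HodgeConjecture.HodgeConjecture.Theorems.SymbolLiftR

open Literature.Geometry.Kaehler Literature.NumberTheory.Transcendental
open Literature.AlgebraicGeometry.Modules

namespace CupStep

section Zigzag

variable {E : Type*} [NormedAddCommGroup E] [NormedSpace ℝ E] {H : Type*} [TopologicalSpace H]
  {I : ModelWithCorners ℝ E H} {M : Type*} [TopologicalSpace M] [ChartedSpace H M]
  {A : Type*} [NormedCommRing A] [NormedAlgebra ℝ A] {κ : Type*} {U : κ → Set M}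
  (hU : ∀ i, IsOpen (U i)) [IsManifold I ∞ M]

/-- **Transgressions refine**: a zig-zag on the cover `U⁰` restricts along a refinement
`U_k ⊆ U⁰_{f k}` to a zig-zag on `U` with the re-indexed top `J ↦ w_{f ∘ J}` and the same bottom
form: the restricted cochains `(Z|_f)_J = Z_{f ∘ J}|_{U_J}` do, since `δ` and `d` commute with the
restriction (`localD_restrictₗ`). [cite: BottTu1982Forms, §8 Prop. 8.8] -/
theorem isTransgression_comap {ι : Type*} {U₀ : ι → Set M} {hU₀ : ∀ i, IsOpen (U₀ i)} {q : ℕ}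
    {w : (Fin (q + 2) → ι) → MForm I M A (q + 1)} {θ : MForm I M A (2 * q + 1 + 1)}
    (h : IsTransgression hU₀ q w θ) (f : κ → ι) (hf : ∀ k, U k ⊆ U₀ (f k)) :
    IsTransgression hU q (fun J ↦ w (f ∘ J)) θ := by
  obtain ⟨Z, ht, hs, hb⟩ := h
  -- restriction of cochains of `U₀` along `f`
  let res : (a b : ℕ) → CechForms I A U₀ a b → CechForms I A U a b := fun a b c J ↦
    restrictₗ I A b (isOpen_cechSet hU J) (cechSet_subset_cechSet_comp hf J) (c (f ∘ J))
  have coe_res : ∀ (a b : ℕ) (c : CechForms I A U₀ a b) (J : Fin (a + 1) → κ),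
      (res a b c J : MForm I M A b) = (c (f ∘ J) : MForm I M A b).restr (cechSet U J) :=
    fun _ _ _ _ ↦ rfl
  have res_δ : ∀ (a b : ℕ) (c : CechForms I A U₀ a b),
      cechδ I A hU a b (res a b c) = res (a + 1) b (cechδ I A hU₀ a b c) := by
    intro a b c
    funext J
    apply Subtype.ext
    rw [coe_cechδ_apply, coe_res, coe_cechδ_apply, MForm.restr_sum]
    refine Finset.sum_congr rfl fun j _ ↦ ?_
    rw [coe_res, MForm.restr_smul, MForm.restr_restr_of_subset (cechSet_subset_comp U J _),
      MForm.restr_restr_of_subset (cechSet_subset_cechSet_comp hf J)]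
    rfl
  have res_d : ∀ (a b : ℕ) (c : CechForms I A U₀ a b),
      cechd I A hU a b (res a b c) = res a (b + 1) (cechd I A hU₀ a b c) := by
    intro a b c
    funext J
    change (-1 : ℝ) ^ a • localD I A b (isOpen_cechSet hU J)
        (restrictₗ I A b (isOpen_cechSet hU J) (cechSet_subset_cechSet_comp hf J) (c (f ∘ J))) =
      restrictₗ I A (b + 1) (isOpen_cechSet hU J) (cechSet_subset_cechSet_comp hf J)
        ((-1 : ℝ) ^ a • localD I A b (isOpen_cechSet hU₀ (f ∘ J)) (c (f ∘ J)))
    rw [localD_restrictₗ, LinearMap.map_smul]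
  refine ⟨fun a b ↦ res a b (Z a b), fun J z hz ↦ ?_, fun a b hab ha ↦ ?_, fun J z hz ↦ ?_⟩
  · rw [res_δ, coe_res, MForm.restr_apply_of_mem _ hz]
    exact ht (f ∘ J) z (cechSet_subset_cechSet_comp hf J hz)
  · rw [res_d, res_δ, hs a b hab ha]
  · rw [res_d, coe_res, MForm.restr_apply_of_mem _ hz]
    exact hb (f ∘ J) z (cechSet_subset_cechSet_comp hf J hz)

/-- The top of a transgression may be replaced by any family agreeing with it on the `U_J`.
[folklore] -/
theorem isTransgression_congr_top {q : ℕ} {w w₁ : (Fin (q + 2) → κ) → MForm I M A (q + 1)}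
    {θ : MForm I M A (2 * q + 1 + 1)} (h : IsTransgression hU q w θ)
    (hw : ∀ J, ∀ z ∈ cechSet U J, w J z = w₁ J z) : IsTransgression hU q w₁ θ := by
  obtain ⟨Z, ht, hs, hb⟩ := h
  exact ⟨Z, fun J z hz ↦ (ht J z hz).trans (hw J z hz), hs, hb⟩

set_option maxHeartbeats 400000 in
/-- **Transgressions multiply** (Bott–Tu (1982), §8–§9: the Čech–de Rham isomorphism is
multiplicative; here for a weight-one second factor). If `θ` transgresses the cochain `w`
(parameter `q`) and `θ'` transgresses the `1`-cochain `w'` (parameter `0`) on the same cover, then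
`(-1)^{q+1} θ ∧ θ'` transgresses the cup product `J ↦ w_{J₀…J_{q+1}} ∧ w'_{J_{q+1} J_{q+2}}`
(parameter `q + 1`). The zig-zag is `Y_{a+1, c+1} = (-1)^{a+q} Z_{a,c} ∪ δα`,
`Y_{0,2q+3} = (-1)^{q+1} rθ ∪ α` (zero elsewhere in the column `0`), where `(α, θ')` is the weight-one
zig-zag and `rθ` the restriction of `θ`; the clauses follow from the Leibniz rules
`δ(x ∪ δα) = δx ∪ δα`, `δ(rθ ∪ α) = rθ ∪ δα`, `cechd (x ∪ δα) = -(cechd x) ∪ δα`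
(`dδα = δdα = δ rθ' = 0`) and `d(rθ ∪ α) = rθ ∪ dα = r(θ ∧ θ')` (`dθ = 0`).
[cite: BottTu1982Forms, §8 Prop. 8.8 and Thm. 14.28] -/
theorem isTransgression_cup {q : ℕ} {w : (Fin (q + 2) → κ) → MForm I M A (q + 1)}
    {θ : MForm I M A (2 * q + 1 + 1)} {w' : (Fin (0 + 2) → κ) → MForm I M A (0 + 1)}
    {θ' : MForm I M A (2 * 0 + 1 + 1)} (h : IsTransgression hU q w θ) (h' : IsTransgression hU 0 w' θ')
    (hθ : IsSmoothForm θ) (hθc : IsClosedForm θ) :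
    IsTransgression hU (q + 1) (fun J ↦ (w (J ∘ Fin.castSucc)).wedge (w' (Cech.back (q + 1) J)))
      ((-1 : ℝ) ^ (q + 1) • θ.wedge θ') := by
  obtain ⟨Z, ht, hs, hb⟩ := h
  obtain ⟨Z', ht', -, hb'⟩ := h'
  -- the weight-one data `α`, `W = δα`
  let α : CechForms I A U 0 1 := Z' 0 1
  let W : CechForms I A U 1 1 := cechδ I A hU 0 1 α
  have htop' : ∀ (T : Fin 2 → κ), ∀ z ∈ cechSet U T, (W T : MForm I M A 1) z = w' T z := ht'
  have hbot' : ∀ (J : Fin 1 → κ), ∀ z ∈ cechSet U J,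
      (cechd I A hU 0 1 α J : MForm I M A 2) z = θ' z := hb'
  have hWδ : cechδ I A hU 1 1 W = 0 := (cechDeRham I A hU).δ_δ 0 1 α
  have hdα : cechδ I A hU 0 (1 + 1) (cechd I A hU 0 1 α) = 0 := by
    refine cechForms_ext fun T z hz ↦ ?_
    rw [coe_cechδ_apply_apply_of_mem hU _ hz, Fin.sum_univ_two,
      hbot' _ z (cechSet_subset_comp U T (Fin.succAbove 0) hz),
      hbot' _ z (cechSet_subset_comp U T (Fin.succAbove 1) hz)]
    simp
  have hWd : ∀ T, localD I A 1 (isOpen_cechSet hU T) (W T) = 0 := by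
    intro T
    have hanti := (cechDeRham I A hU).anticomm 0 1 α
    change cechδ I A hU 0 (1 + 1) (cechd I A hU 0 1 α) + cechd I A hU (0 + 1) 1 W = 0 at hanti
    have hT := congrFun hanti T
    rw [Pi.add_apply, Pi.zero_apply] at hT
    have hT' := eq_neg_of_add_eq_zero_right hT
    rw [hdα, Pi.zero_apply, neg_zero, cechd_apply] at hT'
    exact (smul_eq_zero_iff_right (pow_ne_zero _ (by norm_num))).1 hT'
  -- the restriction `R = rθ` of the bottom form `θ`
  let θu : smoothFormsOn I A (Set.univ : Set M) (2 * q + 1 + 1) := ⟨θ, by rwa [smoothFormsOn_univ]⟩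
  let R : CechForms I A U 0 (2 * q + 1 + 1) := (cechDeRhamRow I A hU).ε (2 * q + 1 + 1) θu
  have hRδ : cechδ I A hU 0 (2 * q + 1 + 1) R = 0 := (cechDeRhamRow I A hU).δ_ε _ θu
  have hRapply : ∀ (J : Fin 1 → κ), ∀ z ∈ cechSet U J,
      (R J : MForm I M A (2 * q + 1 + 1)) z = θ z := fun J z hz ↦ by
    change (θ.restr (cechSet U J)) z = θ z
    rw [MForm.restr_apply_of_mem _ hz]
  have hRd : ∀ (J : Fin 1 → κ), ∀ z ∈ cechSet U J,
      mextDeriv (R J : MForm I M A (2 * q + 1 + 1)) z = 0 := fun J z hz ↦ by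
    change mextDeriv (θ.restr (cechSet U J)) z = 0
    rw [mextDeriv_restr_apply (isOpen_cechSet hU J) _ hz]
    exact congrFun hθc z
  have hZR : cechd I A hU 0 (2 * q + 1) (Z 0 (2 * q + 1)) = R :=
    cechForms_ext fun J z hz ↦ by rw [hb J z hz, hRapply J z hz]
  -- the product zig-zag: column `0` is `(-1)^{q+1} rθ ∪ α` in degree `2q + 3`, then `± Z ∪ W`
  let Y₀ : (b : ℕ) → CechForms I A U 0 b :=
    Pi.single (2 * q + 1 + 1 + 1) (((-1 : ℝ) ^ (q + 1)) • cupZero R α)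
  let Y : (a b : ℕ) → CechForms I A U a b := fun a b ↦
    match a, b with
    | 0, b => Y₀ b
    | _ + 1, 0 => 0
    | a + 1, c + 1 => ((-1 : ℝ) ^ (a + q)) • cupOne hU (Z a c) W
  have e00 : Y 0 (2 * q + 1 + 1 + 1) = ((-1 : ℝ) ^ (q + 1)) • cupZero R α :=
    Pi.single_eq_same (M := fun b ↦ CechForms I A U 0 b) (2 * q + 1 + 1 + 1) _
  refine ⟨Y, fun J z hz ↦ ?_, fun a b hab ha ↦ ?_, fun J z hz ↦ ?_⟩
  · -- top: `δ(Z_{q,q+1} ∪ W) = δZ ∪ W = w ∪ w'`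
    have e : Y (q + 1) (q + 1 + 1) = ((-1 : ℝ) ^ (q + q)) • cupOne hU (Z q (q + 1)) W := rfl
    change _ = ((w (J ∘ Fin.castSucc)).wedge (w' (Cech.back (q + 1) J))) z
    rw [e, LinearMap.map_smul, ← two_mul, pow_mul, neg_one_sq, one_pow, one_smul, cechδ_cupOne hU _ hWδ,
      cupOne_apply_of_mem hU _ _ hz, MForm.wedge_apply,
      ht (J ∘ Fin.castSucc) z (cechSet_subset_comp U J Fin.castSucc hz),
      htop' (Cech.back (q + 1) J) z (cechSet_subset_comp U J (Fin.natAdd (q + 1) (m := 2)) hz)]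
  · -- steps
    obtain ⟨c, rfl⟩ : ∃ c, b = c + 1 := ⟨b - 1, by omega⟩
    cases a with
    | zero =>
      obtain rfl : c = 2 * q + 1 := by omega
      have e1 : Y (0 + 1) (2 * q + 1 + 1) = ((-1 : ℝ) ^ (0 + q)) • cupOne hU (Z 0 (2 * q + 1)) W := rfl
      rw [e1, e00, LinearMap.map_smul, cechd_cupOne hU _ hWd, hZR, smul_neg, ← neg_smul,
        LinearMap.map_smul, cechδ_cupZero hU hRδ α, show 0 + q = q from Nat.zero_add q, pow_succ,
        mul_neg_one]
    | succ a =>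
      have e1 : Y (a + 1 + 1) (c + 1) = ((-1 : ℝ) ^ (a + 1 + q)) • cupOne hU (Z (a + 1) c) W := rfl
      have e0 : Y (a + 1) (c + 1 + 1) = ((-1 : ℝ) ^ (a + q)) • cupOne hU (Z a (c + 1)) W := rfl
      rw [e1, e0, LinearMap.map_smul, LinearMap.map_smul, cechd_cupOne hU _ hWd, hs a c (by omega) (by omega),
        cechδ_cupOne hU _ hWδ, smul_neg, ← neg_smul]
      congr 1
      rw [show a + 1 + q = a + q + 1 by ring, pow_succ, mul_neg_one, neg_neg]
  · -- bottom: `d(rθ ∪ α) = rθ ∪ dα = θ ∧ θ'` on `U_i` (degrees respelled `2q+3` throughout)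
    have hdα' : mextDeriv (α J : MForm I M A 1) z = θ' z := by
      rw [← localD_apply_of_mem (isOpen_cechSet hU J) (α J) hz, ← hbot' J z hz, cechd_apply, pow_zero,
        one_smul]
    have h2 : ((-1 : ℝ) ^ (2 * q + 1 + 1)) = 1 := by
      rw [show 2 * q + 1 + 1 = 2 * (q + 1) by ring, pow_mul, neg_one_sq, one_pow]
    have key := cechd_smul_cupZero_apply hU R α ((-1 : ℝ) ^ (q + 1)) hz θ θ' (hRapply J z hz) (hRd J z hz)
      hdα' h2
    show ((cechd I A hU 0 (2 * q + 1 + 1 + 1) (Y 0 (2 * q + 1 + 1 + 1)) J :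
        MForm I M A (2 * q + 1 + 1 + 1 + 1))) z = _
    rw [e00]
    exact key

end Zigzag

end CupStep

/-- STUB `stub_cupStepZigzag` (registered sub-goal of item stmt-HodgeConjecture-18702, anchoring this
helper file): **transgressions multiply** — the product zig-zag transgresses the cup product of the
tops to `(-1)^{q+1} θ ∧ θ'` (`CupStep.isTransgression_cup`; Bott–Tu (1982), Prop. 8.8, Thm. 14.28).
[cite: BottTu1982Forms, §8 Prop. 8.8 and Thm. 14.28] -/
theorem stub_cupStepZigzag : ∀ {E : Type*} [NormedAddCommGroup E] [NormedSpace ℝ E] {H : Type*} [TopologicalSpace H] {I : ModelWithCorners ℝ E H} {M : Type*} [TopologicalSpace M] [ChartedSpace H M] {A : Type*} [NormedCommRing A] [NormedAlgebra ℝ A] {κ : Type*} {U : κ → Set M} (hU : ∀ i, IsOpen (U i)) [IsManifold I ∞ M] {q : ℕ} {w : (Fin (q + 2) → κ) → MForm I M A (q + 1)} {θ : MForm I M A (2 * q + 1 + 1)} {w' : (Fin (0 + 2) → κ) → MForm I M A (0 + 1)} {θ' : MForm I M A (2 * 0 + 1 + 1)}, IsTransgression hU q w θ → IsTransgression hU 0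 w' θ' → IsSmoothForm θ → IsClosedForm θ → IsTransgression hU (q + 1) (fun J ↦ (w (J ∘ Fin.castSucc)).wedge (w' (Literature.AlgebraicGeometry.Modules.Cech.back (q + 1) J))) ((-1 : ℝ) ^ (q + 1) • θ.wedge θ') := by
  intros
  exact CupStep.isTransgression_cup _ ‹_› ‹_› ‹_› ‹_›

end Summit.HodgeConjecture.HodgeConjecture.Theorems.SymbolLiftR
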